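import Summits.QuantumFields.YangMills.Theorems.LuscherReductionDressedRitzPolyakovLiftUniversality
import HarnessLib

/-!
# Route `LuscherReduction`, item `DressedRitz` (stmt-QuantumFields-20205), line «polyakovlift» — the ∃-BASIS form of the one-site shadow target (B)
# and its composition with (A)

Support module (LEAD prover ym-lead-20205-polyakovlift g0; `--supports stmt-QuantumFields-20205`, helper).  `PScalingDressedAt k` (tree
`…PolyakovLiftUniversality.lean`) asks the one-site clauses for EVERY lift basis up to relabelling; the stub S-POS it feeds is an `∃`-basis statement,
so the kinder and SUFFICIENT target for a ONE-type seat is the `∃`-basis form: the prover CHOOSES the one-site eigen-ratio basis (symmetry-adapted,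
labelled at will) — no uniformity over rotations inside degenerate multiplets is asked.

* `PScalingExistsAt k` — ∃-basis form of (B);  `pscalingExists_of_pscalingDressed` (∀-form ⇒ ∃-form, via `exists_liftBasis`);
* ★ `liftPositionR3_of_universality_pscalingExists : (∀ k, UniversalityAt k) → (∀ k, PScalingExistsAt k) → LiftPositionR3` — the recommended split
  of S-POS: S-UNIV := `∀ k, UniversalityAt k` (field theory, XL) and S-PSCAL := `∀ k, PScalingExistsAt k` (one-site, L).

HONEST FRAMING: typing + pure-real composition on the conditional femto rung R2b1; both inputs are OPEN; nothing here bears on infinite volume, the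
continuum limit or the Clay gap.  References: M. Lüscher, NPB 219 (1983) 233 [cite: Luscher1983, §3].
-/

set_option autoImplicit false

noncomputable section

open MeasureTheory Filter Topology Real
open Literature.MathematicalPhysics.QuantumFieldTheory (GaugeConfig Site gaugeTransform)
open scoped BigOperators

namespace Summit.QuantumFields.YangMills.Theorems.FemtoTransferGap.PolyakovLift

open Summit.QuantumFields.YangMills.Theorems.FemtoTransferGap

/-- **(B∃) `PScalingExistsAt k`** — ∃-basis form of the one-site shadow target: for small `Λ`, large `L`, every one-site raw vacuum `e₀` at
`B = 2L³/Λ³`, THERE IS a lift basis `(ω, g)` at `B₁ = 2/Λ³` whose shadow family has positive norms, Lüscher position against `μ_{i+1}(B)/μ₀(B)`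
(tolerance `e^{±CΛ²/L}`) and coupling defects `≤ C(Λ²/L)μ₀√(n n)`. [cite: Luscher1983, §3] -/
def PScalingExistsAt (k : ℕ) : Prop :=
  ∃ C lam0 : ℝ, 0 ≤ C ∧ 0 < lam0 ∧ ∀ lam : ℝ, 0 < lam → lam ≤ lam0 → ∃ L0 : ℕ, ∀ L : ℕ, L0 ≤ L →
    ∀ Λ : ℝ, lam ≤ Λ → Λ ≤ 2 * lam →
      ∀ e₀ : GaugeConfig 3 1 SU2 → ℝ, IsRawVacuum (L := 1) (2 * (L : ℝ) ^ 3 / Λ ^ 3) e₀ →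
        ∃ (ω : GaugeConfig 3 1 SU2 → ℝ) (g : Fin k → (GaugeConfig 3 1 SU2 → ℝ)), LiftBasis (2 / Λ ^ 3) k ω g ∧
          let B : ℝ := 2 * (L : ℝ) ^ 3 / Λ ^ 3
          let w : Fin k → (GaugeConfig 3 1 SU2 → ℝ) := shadowFamily B L e₀ g
          let m0 := levelValue su2Rep 1 B 0
          (∀ i : Fin k, 0 < l2 (w i) (w i)) ∧
          (∀ i : Fin k,
            l2 (w i) (transferApply B (w i)) * m0 ≤ Real.exp (C * Λ ^ 2 / L) * (levelValue su2Rep 1 B ((i : ℕ) + 1) * m0) * l2 (w i) (w i) ∧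
            levelValue su2Rep 1 B ((i : ℕ) + 1) * m0 * l2 (w i) (w i) ≤ Real.exp (C * Λ ^ 2 / L) * (l2 (w i) (transferApply B (w i)) * m0)) ∧
          (∀ i l : Fin k, i ≠ l →
            |l2 (w i) (transferApply B (w l)) -
                (l2 (w i) (transferApply B (w i)) / l2 (w i) (w i) + l2 (w l) (transferApply B (w l)) / l2 (w l) (w l)) / 2 *
                  l2 (w i) (w l)|
              ≤ C * (Λ ^ 2 / L) * m0 * (Real.sqrt (l2 (w i) (w i)) * Real.sqrt (l2 (w l) (w l))))

/-- The ∀-basis form implies the ∃-basis form (a lift basis exists at every `B₁ > 0`: `exists_liftBasis`). [folklore] -/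
theorem pscalingExists_of_pscalingDressed {k : ℕ} (h : PScalingDressedAt k) : PScalingExistsAt k := by
  obtain ⟨C, lam0, hC, hlam0, hk⟩ := h
  refine ⟨C, lam0, hC, hlam0, fun lam hlam hle => ?_⟩
  obtain ⟨L0, hL⟩ := hk lam hlam hle
  refine ⟨L0, fun L hL0 Λ hlo hhi e₀ he₀ => ?_⟩
  have hΛ : 0 < Λ := hlam.trans_le hlo
  obtain ⟨ω, g, hbasis⟩ := exists_liftBasis (B := 2 / Λ ^ 3) (div_pos two_pos (pow_pos hΛ 3)) k
  obtain ⟨τ, h0, h5, h6⟩ := hL L hL0 Λ hlo hhi ω g hbasis e₀ he₀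
  exact ⟨ω, fun i => g (τ i), liftBasis_reindex hbasis τ, h0, h5, h6⟩

/-- ★★ **(A) ∧ (B∃) ⟹ the r3 text of S-POS**: take the basis supplied by `PScalingExistsAt` at `Λ = λ(β,L)`, read `UniversalityAt` for it, transfer
(o5′)(o6′) to the fine dressed family (`o5_transfer`, `o6_transfer`; constant `4(C_A + C_B)`). [cite: Luscher1983, §3] -/
theorem liftPositionR3_of_universality_pscalingExists (hA : ∀ k, UniversalityAt k) (hB : ∀ k, PScalingExistsAt k) :
    LiftPositionR3 := by
  intro k
  obtain ⟨CA, lA, hCA, hlA, hAk⟩ := hA k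
  obtain ⟨CB, lB, hCB, hlB, hBk⟩ := hB k
  refine ⟨4 * (CA + CB), min lA (min lB (1 / (4 * (CA + 1)))), by positivity, lt_min hlA (lt_min hlB (by positivity)),
    fun lam hlam hle => ?_⟩
  obtain ⟨LA, hLA⟩ := hAk lam hlam (hle.trans (min_le_left _ _))
  obtain ⟨LB, hLB⟩ := hBk lam hlam (hle.trans ((min_le_right _ _).trans (min_le_left _ _)))
  have hlamC : lam ≤ 1 / (4 * (CA + 1)) := (hle.trans (min_le_right _ _)).trans (min_le_right _ _)
  refine ⟨max LA LB, fun L _ hL β hW φ hφ => ?_⟩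
  have hleA : LA ≤ L := (le_max_left _ _).trans hL
  have hleB : LB ≤ L := (le_max_right _ _).trans hL
  have hβ0 : 0 ≤ β := zero_le_one.trans hW.1
  have hΛpos : 0 < luscherLambda β L := luscherLambda_pos_of_window hlam hW
  have hLpos : (0 : ℝ) < L := Nat.cast_pos.mpr (NeZero.pos L)
  have hBpos : 0 < oneSiteCoupling β L := by
    unfold oneSiteCoupling; exact div_pos (mul_pos two_pos (pow_pos hLpos 3)) (pow_pos hΛpos 3)
  obtain ⟨e₀, θ, c, he₀, -, -, hn₀, heig₀, -, -, -⟩ := PhysL2.exists_groundState (L := 1) (oneSiteCoupling β L)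
  have heig₀' : transferApply (oneSiteCoupling β L) e₀ = levelValue su2Rep 1 (oneSiteCoupling β L) 0 • e₀ := by
    rw [levelValue_zero]; exact heig₀
  have hvac₀ : IsRawVacuum (L := 1) (oneSiteCoupling β L) e₀ := ⟨he₀, hn₀, heig₀'⟩
  obtain ⟨ω, g, hbasis, hB0, hB5, hB6⟩ := hLB L hleB (luscherLambda β L) hW.2.1 hW.2.2 e₀ hvac₀
  have hbasis' : LiftBasis (liftCoupling β L) k ω g := hbasis
  obtain ⟨hAn, hA5, hA6⟩ := hLA L hleA β hW φ hφ ω g hbasis' e₀ hvac₀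
  set u := dressedLiftFamily β φ g with hu
  set w := shadowFamily (oneSiteCoupling β L) L e₀ g with hw
  set l0 := levelValue su2Rep L β 0 with hl0
  set m0 := levelValue su2Rep 1 (oneSiteCoupling β L) 0 with hm0
  have hm0pos : 0 < m0 := levelValue_su2Rep_pos (L := 1) hBpos 0
  have hl0nn : 0 ≤ l0 := levelValue_su2Rep_nonneg L hβ0 0
  have huP : ∀ i, IsPhys (u i) := fun i => isPhys_dressedLiftVec β hφ.1 (hbasis'.2.2.2.2.1 i)
  have hEA : 0 < Real.exp (CA * luscherLambda β L ^ 2 / L) := Real.exp_pos _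
  have hEB : 0 < Real.exp (CB * luscherLambda β L ^ 2 / L) := Real.exp_pos _
  have hEE : Real.exp (CA * luscherLambda β L ^ 2 / L) * Real.exp (CB * luscherLambda β L ^ 2 / L) ≤
      Real.exp (4 * (CA + CB) * luscherLambda β L ^ 2 / L) := by
    rw [← Real.exp_add]
    apply Real.exp_le_exp.mpr
    have : 0 ≤ (CA + CB) * luscherLambda β L ^ 2 / L := div_nonneg (mul_nonneg (add_nonneg hCA hCB) (sq_nonneg _)) hLpos.le
    have e : CA * luscherLambda β L ^ 2 / ↑L + CB * luscherLambda β L ^ 2 / ↑L = (CA + CB) * luscherLambda β L ^ 2 / L := by ring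
    have e' : 4 * (CA + CB) * luscherLambda β L ^ 2 / ↑L = 4 * ((CA + CB) * luscherLambda β L ^ 2 / L) := by ring
    rw [e, e']; linarith
  have hCAl : CA * luscherLambda β L ≤ 1 / 2 := by
    have h1 : luscherLambda β L ≤ 2 * lam := hW.2.2
    have h2 : CA * luscherLambda β L ≤ CA * (2 * (1 / (4 * (CA + 1)))) :=
      mul_le_mul_of_nonneg_left (h1.trans (by linarith)) hCA
    have h3 : CA * (2 * (1 / (4 * (CA + 1)))) = (CA / (CA + 1)) * (1 / 2) := by field_simp; ring
    have h4 : CA / (CA + 1) ≤ 1 := by rw [div_le_one (by linarith)]; linarith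
    calc CA * luscherLambda β L ≤ (CA / (CA + 1)) * (1 / 2) := h2.trans (le_of_eq h3)
      _ ≤ 1 * (1 / 2) := mul_le_mul_of_nonneg_right h4 (by norm_num)
      _ = 1 / 2 := one_mul _
  have hnw_le : ∀ i : Fin k, l2 (w i) (w i) ≤ 2 * l2 (u i) (u i) := fun i => by
    have h := (abs_le.mp (hAn i)).1
    have hnw : 0 ≤ l2 (w i) (w i) := l2_self_nonneg _
    nlinarith [mul_le_mul_of_nonneg_right hCAl hnw]
  refine ⟨ω, g, hbasis', fun i => ?_, fun i l hil => ?_⟩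
  · have hdf : 0 ≤ l2 (u i) (transferApply β (u i)) := by
      rw [← qform_eq_l2_transferApply]; exact qform_su2Rep_self_nonneg hβ0 (huP i)
    obtain ⟨h1, h2⟩ := o5_transfer (hB0 i) hm0pos (l2_self_nonneg (u i)) hl0nn hEA hEB (hA5 i).1 (hA5 i).2 (hB5 i).1 (hB5 i).2
    have hY1 : 0 ≤ levelValue su2Rep 1 (oneSiteCoupling β L) ((i : ℕ) + 1) * l0 * l2 (u i) (u i) :=
      mul_nonneg (mul_nonneg (levelValue_su2Rep_nonneg 1 hBpos.le _) hl0nn) (l2_self_nonneg _)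
    have hY2 : 0 ≤ l2 (u i) (transferApply β (u i)) * m0 := mul_nonneg hdf hm0pos.le
    constructor
    · calc l2 (u i) (transferApply β (u i)) * m0
          ≤ Real.exp (CA * luscherLambda β L ^ 2 / L) * Real.exp (CB * luscherLambda β L ^ 2 / L) *
              (levelValue su2Rep 1 (oneSiteCoupling β L) ((i : ℕ) + 1) * l0) * l2 (u i) (u i) := h1
        _ = Real.exp (CA * luscherLambda β L ^ 2 / L) * Real.exp (CB * luscherLambda β L ^ 2 / L) *
              (levelValue su2Rep 1 (oneSiteCoupling β L) ((i : ℕ) + 1) * l0 * l2 (u i) (u i)) := by ring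
        _ ≤ Real.exp (4 * (CA + CB) * luscherLambda β L ^ 2 / L) *
              (levelValue su2Rep 1 (oneSiteCoupling β L) ((i : ℕ) + 1) * l0 * l2 (u i) (u i)) := mul_le_mul_of_nonneg_right hEE hY1
        _ = Real.exp (4 * (CA + CB) * luscherLambda β L ^ 2 / L) *
              (levelValue su2Rep 1 (oneSiteCoupling β L) ((i : ℕ) + 1) * l0) * l2 (u i) (u i) := by ring
    · calc levelValue su2Rep 1 (oneSiteCoupling β L) ((i : ℕ) + 1) * l0 * l2 (u i) (u i)
          ≤ Real.exp (CA * luscherLambda β L ^ 2 / L) * Real.exp (CB * luscherLambda β L ^ 2 / L) *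
              (l2 (u i) (transferApply β (u i)) * m0) := h2
        _ ≤ Real.exp (4 * (CA + CB) * luscherLambda β L ^ 2 / L) * (l2 (u i) (transferApply β (u i)) * m0) :=
            mul_le_mul_of_nonneg_right hEE hY2
  · have hs : Real.sqrt (l2 (w i) (w i)) * Real.sqrt (l2 (w l) (w l)) ≤
        2 * (Real.sqrt (l2 (u i) (u i)) * Real.sqrt (l2 (u l) (u l))) :=
      sqrt_mul_sqrt_le_two (hnw_le i) (hnw_le l)
    have ht2 : 0 ≤ luscherLambda β L ^ 2 / L := div_nonneg (sq_nonneg _) hLpos.le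
    have h := o6_transfer hm0pos hl0nn (hA6 i l hil) (hB6 i l hil) hs (mul_nonneg hCA ht2) (mul_nonneg hCB ht2)
    calc _ ≤ 2 * (CA * (luscherLambda β L ^ 2 / L) + CB * (luscherLambda β L ^ 2 / L)) * l0 *
            (Real.sqrt (l2 (u i) (u i)) * Real.sqrt (l2 (u l) (u l))) := h
      _ ≤ 4 * (CA + CB) * (luscherLambda β L ^ 2 / L) * l0 * (Real.sqrt (l2 (u i) (u i)) * Real.sqrt (l2 (u l) (u l))) := by
          have hx : 0 ≤ (CA + CB) * (luscherLambda β L ^ 2 / L) * l0 * (Real.sqrt (l2 (u i) (u i)) * Real.sqrt (l2 (u l) (u l))) :=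
            mul_nonneg (mul_nonneg (mul_nonneg (add_nonneg hCA hCB) ht2) hl0nn) (mul_nonneg (Real.sqrt_nonneg _) (Real.sqrt_nonneg _))
          nlinarith

end Summit.QuantumFields.YangMills.Theorems.FemtoTransferGap.PolyakovLift

end
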